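import Mathlib
import HarnessLib
import Summits.Ventures.LatticeQCDFlow.Scaling.JarzynskiSampleSize
import Summits.Ventures.LatticeQCDFlow.Scaling.PathWorkMoments

/-!
# KishSampleSize — the sample-size law of the Kish ESS DENOMINATOR of an NE-MCMC protocol
# (Chatterjee–Diaconis with the doubly-tilted path law as target): the sample second moment of
# the Jarzynski weights needs `N ≈ ÊSS·exp(2(ΔF − ⟨W⟩₂))` forward evolutions; with fewer it
# UNDER-shoots `1/ÊSS` — the printed Kish fraction is over-optimistic — except on a small event;
# and the endpoint-observable form of the reweighting sufficiency

HONEST FRAMING: exact (Metropolis-corrected) sampling algorithms for lattice gauge theory;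
figures of merit are autocorrelation/cost numbers at stated couplings and volumes; no
continuum-physics claim.

Venture `LatticeQCDFlow` (cell pub-lqcd), topic `Scaling`; FANOUT row 19 (`su2-snf`, GEN-7).
A second DOCKING of the Literature's Chatterjee–Diaconis sample-size theorem
(`Literature/Probability/ImportanceSampling/ChatterjeeDiaconis`, Thm 1.1, proved there) through
the finite-law dictionary of `Scaling/JarzynskiSampleSize` (this seat: `lawMeasure`, `pathMeasure`,
`finite_sampleSize_necessary/sufficient`).  Nothing is cited as a fact; nothing is re-proved.

THE POINT.  The LEADERBOARD's ESS column for an NE-MCMC arm is the sample Kish fraction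
`(Σ wᵢ)²/(N Σ wᵢ²)`, `wᵢ = e^{−(Wᵢ − ΔF)}`; its denominator is the sample second moment
`M̂₂ = (1/N) Σ wᵢ²` of the population value `M₂ = E_F[e^{−2(W−ΔF)}] = 1/ÊSS`
(`Scaling/PathWorkMoments.inv_essFrac_path_eq_sum_exp_two`).  Estimating `M₂` from forward
evolutions IS importance sampling of the constant `1` with proposal `P_F` and target the
DOUBLY-TILTED path law `P₂(ω) = P_F(ω)·e^{−2(W(ω)−ΔF)}·ÊSS` (`sqTiltPathLaw`), whose likelihood ratio
is `w²·ÊSS`; Chatterjee–Diaconis then prices it at `N ≈ exp D(P₂‖P_F)` draws, and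

  **`D(P₂ ‖ P_F) = log ÊSS + 2·(ΔF − ⟨W⟩₂)`**  (`klFin_sqTiltPathLaw`),

`⟨W⟩₂` the mean of the work functional under `P₂` (in the Gaussian work model of
`Scaling/GaussianWorkSampleSize` this is `−s + 2·(3s/2) = 2s`, the `k = 2` threshold `1/ESS²`).

* `sqTiltPathLaw` (+ `_nonneg`, `sum_sqTiltPathLaw` = 1, `sqTiltPathLaw_div_pathLaw` = `w²·ÊSS`);
* **`kish_sampleSize_necessary`** — `t ≥ 0`, `N ≤ exp(D(P₂‖P_F) − t)`, `δ ∈ (0,1)`: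
  `P_F^{⊗N}{ ÊSS·M̂₂ ≥ 1 − δ } ≤ e^{−t/2} + P₂{W ≥ ⟨W⟩₂ + t/4}/(1 − δ)` — with too few INDEPENDENT
  forward evolutions the sample second moment falls below `(1 − δ)/ÊSS` except on that event, so a
  Kish fraction computed from them over-states the population ESS by the factor `1/(1 − δ)` up to
  the fluctuation of its numerator (NOT bounded here);
* **`kish_sampleSize_sufficient`** — `N ≥ exp(D(P₂‖P_F) + t)`:
  `E|ÊSS·M̂₂ − 1| ≤ e^{−t/4} + 2·√(P₂{W < ⟨W⟩₂ − t/4})`;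
* **`reweighting_sampleSize_sufficient_endpoint`** — the endpoint form of
  `jarzynski_sampleSize_sufficient`: for an observable `O` of the FINAL configuration,
  `N ≥ exp(ΔF − ⟨W⟩_R̃ + t)` forward evolutions give
  `E|(1/N)Σ O(ωⁱ_n) e^{−(Wᵢ−ΔF)} − ⟨O⟩_{π_n}| ≤ ‖O‖_{L²(π_n)}·(e^{−t/4} + 2√(P̃_R{W < ⟨W⟩_R̃ − t/2}))`
  — the NE-MCMC reweighting estimator of a TARGET expectation (`π_n = gibbsLaw (S n)`, by
  `coarse_last_revPathLaw`: the reverse path law ends in the target).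

* §4 **`reverseDissipation_le_neg_log_ess`** (`D(P̃_R‖P_F) ≤ −log ÊSS`, T2-A on path space) and
  **`jarzynski_sampleSize_sufficient_of_ess`**: `N ≥ e^{t}/ÊSS` independent forward evolutions
  SUFFICE for the reweighting estimate of any path functional — with the certified floor
  `ÊSS ≥ exp(−2τ̄σ̄²/n)` of this seat's general-layer files, `N ≥ exp(t + 2τ̄σ̄²/n)`.

NOT CLAIMED: a bound on the sample Kish fraction itself (ratio of two sample means; row 4's
`Scoring/KishESS*` files treat it by block medians under moment hypotheses); correlated evolutions;
any value of `⟨W⟩₂` for a lattice protocol.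
-/

namespace Summit.Ventures.LatticeQCDFlow.Theory2

open Finset MeasureTheory
open Literature.Probability.MarkovChains (IsRowStochastic IsStationary)
open Summit.Ventures.LatticeQCDFlow.Exactness
open Summit.Ventures.LatticeQCDFlow.Scaling (inv_essFrac_path_eq_sum_exp_two)

variable {X : Type*} [Fintype X] [Nonempty X]
variable {n : ℕ}

/-! ## §1 The doubly-tilted path law `P₂ = P_F·w²·ÊSS` -/

/-- The DOUBLY-TILTED path law `P₂(ω) = P_F(ω)·e^{−2(W(ω) − ΔF)}·ÊSS`: the law whose importance
sampling from forward evolutions is the estimation of the Kish denominator `E_F[w²] = 1/ÊSS`. -/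
noncomputable def sqTiltPathLaw (S : Fin (n + 1) → X → ℝ) (P : Fin n → X → X → ℝ)
    (ω : Fin (n + 1) → X) : ℝ :=
  pathLaw (gibbsLaw (S 0)) P ω
    * Real.exp (-(2 * (work S ω - (freeEnergy (S (Fin.last n)) - freeEnergy (S 0)))))
    * essFrac (revPathLaw S P) (pathLaw (gibbsLaw (S 0)) P)

/-- The path ESS is positive (positive layers, Boltzmann-invariant). -/
theorem essFrac_path_pos (S : Fin (n + 1) → X → ℝ) {P : Fin n → X → X → ℝ}
    (hPpos : ∀ k x y, 0 < P k x y)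
    (hst : ∀ k : Fin n, IsStationary (fun x => Real.exp (-(S k.succ x))) (P k)) :
    0 < essFrac (revPathLaw S P) (pathLaw (gibbsLaw (S 0)) P) :=
  essFrac_pos (pathLaw_pos (gibbsLaw_pos _) hPpos) (sum_revPathLaw S P hst)

/-- `P₂ ≥ 0` (indeed `> 0`). -/
theorem sqTiltPathLaw_nonneg (S : Fin (n + 1) → X → ℝ) {P : Fin n → X → X → ℝ}
    (hPpos : ∀ k x y, 0 < P k x y)
    (hst : ∀ k : Fin n, IsStationary (fun x => Real.exp (-(S k.succ x))) (P k))
    (ω : Fin (n + 1) → X) : 0 ≤ sqTiltPathLaw S P ω :=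
  mul_nonneg (mul_nonneg (pathLaw_pos (gibbsLaw_pos _) hPpos ω).le (Real.exp_pos _).le)
    (essFrac_path_pos S hPpos hst).le

/-- `Σ P₂ = 1`: the normalisation IS `1/ÊSS = E_F[e^{−2(W−ΔF)}]` (`Scaling/PathWorkMoments`). -/
theorem sum_sqTiltPathLaw (S : Fin (n + 1) → X → ℝ) {P : Fin n → X → X → ℝ}
    (hPpos : ∀ k x y, 0 < P k x y)
    (hst : ∀ k : Fin n, IsStationary (fun x => Real.exp (-(S k.succ x))) (P k)) :
    ∑ ω, sqTiltPathLaw S P ω = 1 := by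
  have hst' : ∀ k : Fin n, IsStationary (fun x => Real.exp (-S k.succ x)) (P k) := hst
  have hE := essFrac_path_pos S hPpos hst
  unfold sqTiltPathLaw
  rw [← sum_mul, ← inv_essFrac_path_eq_sum_exp_two S hPpos hst', inv_mul_cancel₀ hE.ne']

/-- The likelihood ratio of `P₂` against `P_F` is `w²·ÊSS = e^{−2(W−ΔF)}·ÊSS`. -/
theorem sqTiltPathLaw_div_pathLaw (S : Fin (n + 1) → X → ℝ) {P : Fin n → X → X → ℝ}
    (hPpos : ∀ k x y, 0 < P k x y) (ω : Fin (n + 1) → X) :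
    sqTiltPathLaw S P ω / pathLaw (gibbsLaw (S 0)) P ω
      = Real.exp (-(2 * (work S ω - (freeEnergy (S (Fin.last n)) - freeEnergy (S 0)))))
          * essFrac (revPathLaw S P) (pathLaw (gibbsLaw (S 0)) P) := by
  have hF : 0 < pathLaw (gibbsLaw (S 0)) P ω := pathLaw_pos (gibbsLaw_pos _) hPpos ω
  unfold sqTiltPathLaw
  field_simp

/-- **`D(P₂ ‖ P_F) = log ÊSS + 2(ΔF − ⟨W⟩₂)`**, `⟨W⟩₂ = Σ P₂ W` the mean work under the
doubly-tilted law: the Chatterjee–Diaconis exponent of the Kish denominator. -/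
theorem klFin_sqTiltPathLaw (S : Fin (n + 1) → X → ℝ) {P : Fin n → X → X → ℝ}
    (hPpos : ∀ k x y, 0 < P k x y)
    (hst : ∀ k : Fin n, IsStationary (fun x => Real.exp (-(S k.succ x))) (P k)) :
    klFin (sqTiltPathLaw S P) (pathLaw (gibbsLaw (S 0)) P)
      = Real.log (essFrac (revPathLaw S P) (pathLaw (gibbsLaw (S 0)) P))
        + 2 * ((freeEnergy (S (Fin.last n)) - freeEnergy (S 0))
          - ∑ ω, sqTiltPathLaw S P ω * work S ω) := by
  have hE := essFrac_path_pos S hPpos hst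
  have h1 := sum_sqTiltPathLaw S hPpos hst
  unfold klFin
  simp_rw [sqTiltPathLaw_div_pathLaw S hPpos, Real.log_mul (Real.exp_pos _).ne' hE.ne',
    Real.log_exp, mul_add, sum_add_distrib, ← sum_mul, h1, one_mul]
  have e : ∀ ω, sqTiltPathLaw S P ω
      * -(2 * (work S ω - (freeEnergy (S (Fin.last n)) - freeEnergy (S 0))))
      = 2 * (freeEnergy (S (Fin.last n)) - freeEnergy (S 0)) * sqTiltPathLaw S P ω
        - 2 * (sqTiltPathLaw S P ω * work S ω) := fun ω => by ring
  simp_rw [e, sum_sub_distrib, ← mul_sum, h1]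
  ring

/-! ## §2 The sample-size law of the Kish denominator -/

section Measures

variable [MeasurableSpace X] [MeasurableSingletonClass X]

/-- **KISH DENOMINATOR, NECESSITY.**  With `N ≤ exp(D(P₂‖P_F) − t)` (`t ≥ 0`) INDEPENDENT forward
evolutions and any `δ ∈ (0, 1)`, the sample second moment `M̂₂ = (1/N)Σᵢ e^{−2(Wᵢ−ΔF)}` satisfies
`ÊSS·M̂₂ ≥ 1 − δ` (i.e. `M̂₂ ≥ (1−δ)·E_F[w²]`) only with probability
`≤ e^{−t/2} + P₂{W ≥ ⟨W⟩₂ + t/4}/(1 − δ)`. -/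
theorem kish_sampleSize_necessary (S : Fin (n + 1) → X → ℝ) (P : Fin n → X → X → ℝ)
    (hProw : ∀ k x, ∑ y, P k x y = 1) (hPpos : ∀ k x y, 0 < P k x y)
    (hst : ∀ k : Fin n, IsStationary (fun x => Real.exp (-(S k.succ x))) (P k))
    {t : ℝ} (ht : 0 ≤ t) {N : ℕ}
    (hN : (N : ℝ) ≤ Real.exp (klFin (sqTiltPathLaw S P) (pathLaw (gibbsLaw (S 0)) P) - t))
    {δ : ℝ} (hδ0 : 0 < δ) (hδ1 : δ < 1) :
    ((Measure.pi fun _ : Fin N => pathMeasure S P hProw hPpos)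
        {x | 1 - δ ≤ (1 / (N : ℝ)) * ∑ i,
          Real.exp (-(2 * (work S (x i) - (freeEnergy (S (Fin.last n)) - freeEnergy (S 0)))))
            * essFrac (revPathLaw S P) (pathLaw (gibbsLaw (S 0)) P)}).toReal
      ≤ Real.exp (-t / 2)
        + (∑ ω, if (∑ ω', sqTiltPathLaw S P ω' * work S ω') + t / 4 ≤ work S ω
            then sqTiltPathLaw S P ω else 0) / (1 - δ) := by
  have h2 := sqTiltPathLaw_nonneg S hPpos hst
  have h21 := sum_sqTiltPathLaw S hPpos hst
  have hkl := klFin_sqTiltPathLaw S hPpos hst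
  have h := finite_sampleSize_necessary (fun ω => pathLaw_pos (gibbsLaw_pos _) hPpos ω)
    (sum_pathLaw_gibbsLaw_eq_one S P hProw) h2 h21 ht (N := N) hN hδ0 hδ1
  have hE := essFrac_path_pos S hPpos hst
  simp_rw [sqTiltPathLaw_div_pathLaw S hPpos, Real.log_mul (Real.exp_pos _).ne' hE.ne',
    Real.log_exp, hkl] at h
  have hiff : ∀ ω, (-(2 * (work S ω - (freeEnergy (S (Fin.last n)) - freeEnergy (S 0))))
      + Real.log (essFrac (revPathLaw S P) (pathLaw (gibbsLaw (S 0)) P))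
      ≤ Real.log (essFrac (revPathLaw S P) (pathLaw (gibbsLaw (S 0)) P))
        + 2 * ((freeEnergy (S (Fin.last n)) - freeEnergy (S 0))
          - ∑ ω', sqTiltPathLaw S P ω' * work S ω') - t / 2)
      ↔ ((∑ ω', sqTiltPathLaw S P ω' * work S ω') + t / 4 ≤ work S ω) := fun ω => by
    constructor <;> intro h <;> linarith
  simp_rw [hiff] at h
  exact h

/-- **KISH DENOMINATOR, SUFFICIENCY.**  With `N ≥ exp(D(P₂‖P_F) + t)` (`t ≥ 0`) INDEPENDENT
forward evolutions, `E|ÊSS·M̂₂ − 1| ≤ e^{−t/4} + 2·√(P₂{W < ⟨W⟩₂ − t/4})`: the sample second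
moment of the Jarzynski weights estimates `1/ÊSS` to that relative accuracy. -/
theorem kish_sampleSize_sufficient (S : Fin (n + 1) → X → ℝ) (P : Fin n → X → X → ℝ)
    (hProw : ∀ k x, ∑ y, P k x y = 1) (hPpos : ∀ k x y, 0 < P k x y)
    (hst : ∀ k : Fin n, IsStationary (fun x => Real.exp (-(S k.succ x))) (P k))
    {t : ℝ} (ht : 0 ≤ t) {N : ℕ}
    (hN : Real.exp (klFin (sqTiltPathLaw S P) (pathLaw (gibbsLaw (S 0)) P) + t) ≤ N) :
    ∫ x, |(1 / (N : ℝ)) * ∑ i,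
          Real.exp (-(2 * (work S (x i) - (freeEnergy (S (Fin.last n)) - freeEnergy (S 0)))))
            * essFrac (revPathLaw S P) (pathLaw (gibbsLaw (S 0)) P) - 1|
        ∂(Measure.pi fun _ : Fin N => pathMeasure S P hProw hPpos)
      ≤ Real.exp (-t / 4) + 2 * Real.sqrt
          (∑ ω, if work S ω < (∑ ω', sqTiltPathLaw S P ω' * work S ω') - t / 4
            then sqTiltPathLaw S P ω else 0) := by
  have h2 := sqTiltPathLaw_nonneg S hPpos hst
  have h21 := sum_sqTiltPathLaw S hPpos hst
  have hkl := klFin_sqTiltPathLaw S hPpos hst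
  have h := finite_sampleSize_sufficient (fun ω => pathLaw_pos (gibbsLaw_pos _) hPpos ω)
    (sum_pathLaw_gibbsLaw_eq_one S P hProw) h2 h21 (fun _ => (1 : ℝ)) ht (N := N) hN
  have hE := essFrac_path_pos S hPpos hst
  simp_rw [sqTiltPathLaw_div_pathLaw S hPpos, Real.log_mul (Real.exp_pos _).ne' hE.ne',
    Real.log_exp, hkl, one_pow, mul_one, one_mul, h21, Real.sqrt_one, one_mul] at h
  have hiff : ∀ ω, (Real.log (essFrac (revPathLaw S P) (pathLaw (gibbsLaw (S 0)) P))
      + 2 * ((freeEnergy (S (Fin.last n)) - freeEnergy (S 0))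
        - ∑ ω', sqTiltPathLaw S P ω' * work S ω') + t / 2
      < -(2 * (work S ω - (freeEnergy (S (Fin.last n)) - freeEnergy (S 0))))
        + Real.log (essFrac (revPathLaw S P) (pathLaw (gibbsLaw (S 0)) P)))
      ↔ (work S ω < (∑ ω', sqTiltPathLaw S P ω' * work S ω') - t / 4) := fun ω => by
    constructor <;> intro h <;> linarith
  simp_rw [hiff] at h
  exact h

/-! ## §3 The endpoint form of the reweighting sufficiency -/

omit [Nonempty X] [MeasurableSpace X] [MeasurableSingletonClass X] in
/-- Pushing a path sum through the final configuration: `Σ_ω p(ω) g(ω_n) = Σ_x (coarse last p)(x) g(x)`. -/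
theorem sum_mul_apply_last_eq_sum_coarse [DecidableEq X] (p : (Fin (n + 1) → X) → ℝ) (g : X → ℝ) :
    ∑ ω, p ω * g (ω (Fin.last n))
      = ∑ x, coarse (fun ω : Fin (n + 1) → X => ω (Fin.last n)) p x * g x := by
  unfold coarse
  rw [← Finset.sum_fiberwise univ (fun ω : Fin (n + 1) → X => ω (Fin.last n))
    (fun ω => p ω * g (ω (Fin.last n)))]
  refine sum_congr rfl fun x _ => ?_
  rw [sum_mul]
  refine sum_congr rfl fun ω hω => ?_
  have hx : ω (Fin.last n) = x := (Finset.mem_filter.mp hω).2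
  rw [hx]

/-- **REWEIGHTING A TARGET OBSERVABLE, SUFFICIENCY.**  For an observable `O` of the final
configuration and `N ≥ exp(ΔF − ⟨W⟩_R̃ + t)` INDEPENDENT forward evolutions, the NE-MCMC reweighting
estimator `(1/N)Σᵢ O(ωⁱ_n)·e^{−(Wᵢ−ΔF)}` of the TARGET expectation `⟨O⟩_{π_n}`
(`π_n = gibbsLaw (S n)`) has `E|error| ≤ ‖O‖_{L²(π_n)}·(e^{−t/4} + 2√(P̃_R{W < ⟨W⟩_R̃ − t/2}))`. -/
theorem reweighting_sampleSize_sufficient_endpoint [DecidableEq X] (S : Fin (n + 1) → X → ℝ)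
    (P : Fin n → X → X → ℝ) (hProw : ∀ k x, ∑ y, P k x y = 1) (hPpos : ∀ k x y, 0 < P k x y)
    (hst : ∀ k : Fin n, IsStationary (fun x => Real.exp (-(S k.succ x))) (P k))
    (O : X → ℝ) {t : ℝ} (ht : 0 ≤ t) {N : ℕ}
    (hN : Real.exp ((freeEnergy (S (Fin.last n)) - freeEnergy (S 0)
      - ∑ ω, revPathLaw S P ω * work S ω) + t) ≤ N) :
    ∫ x, |(1 / (N : ℝ)) * ∑ i, O (x i (Fin.last n))
          * Real.exp (-(work S (x i) - (freeEnergy (S (Fin.last n)) - freeEnergy (S 0))))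
        - ∑ y, gibbsLaw (S (Fin.last n)) y * O y|
        ∂(Measure.pi fun _ : Fin N => pathMeasure S P hProw hPpos)
      ≤ Real.sqrt (∑ y, gibbsLaw (S (Fin.last n)) y * O y ^ 2) *
          (Real.exp (-t / 4) + 2 * Real.sqrt
            (∑ ω, if work S ω < (∑ ω', revPathLaw S P ω' * work S ω') - t / 2
              then revPathLaw S P ω else 0)) := by
  have h := jarzynski_sampleSize_sufficient S P hProw hPpos hst (fun ω => O (ω (Fin.last n))) ht hN
  rw [sum_mul_apply_last_eq_sum_coarse (revPathLaw S P) O,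
    sum_mul_apply_last_eq_sum_coarse (revPathLaw S P) (fun y => O y ^ 2),
    coarse_last_revPathLaw S P hst] at h
  exact h

/-! ## §4 Sufficient sample sizes in terms of the population ESS (`KL ≤ log(1/ESS)`, T2-A) -/

omit [MeasurableSpace X] [MeasurableSingletonClass X] in
/-- **The reverse dissipation is at most `−log ÊSS`**: `D(P̃_R ‖ P_F) = ΔF − ⟨W⟩_R̃ ≤ −log ÊSS`
(theory-2's T2-A `ESS ≤ e^{−KL}`, `Scaling/ImportanceWeights.essFrac_le_exp_neg_kl`, on path space). -/
theorem reverseDissipation_le_neg_log_ess (S : Fin (n + 1) → X → ℝ) (P : Fin n → X → X → ℝ)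
    (hPpos : ∀ k x y, 0 < P k x y)
    (hst : ∀ k : Fin n, IsStationary (fun x => Real.exp (-(S k.succ x))) (P k)) :
    (freeEnergy (S (Fin.last n)) - freeEnergy (S 0)) - ∑ ω, revPathLaw S P ω * work S ω
      ≤ -Real.log (essFrac (revPathLaw S P) (pathLaw (gibbsLaw (S 0)) P)) := by
  rw [← klFin_revPathLaw_pathLaw S P hPpos hst]
  have h := essFrac_le_exp_neg_kl (p := revPathLaw S P) (q := pathLaw (gibbsLaw (S 0)) P)
    (revPathLaw_pos S hPpos) (fun ω => pathLaw_pos (gibbsLaw_pos (S 0)) hPpos ω)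
    (sum_revPathLaw S P hst)
  have hE := essFrac_path_pos S hPpos hst
  have := Real.log_le_log hE h
  rw [Real.log_exp] at this
  linarith

/-- **`N ≥ e^{t}/ÊSS` INDEPENDENT FORWARD EVOLUTIONS SUFFICE** for the Jarzynski-reweighted estimate
of any path functional `f` (`jarzynski_sampleSize_sufficient` with `L ≤ −log ÊSS`):
`E|(1/N)Σᵢ f(ωⁱ)e^{−(Wᵢ−ΔF)} − ⟨f⟩_R̃| ≤ √⟨f²⟩_R̃·(e^{−t/4} + 2√(P̃_R{W < ⟨W⟩_R̃ − t/2}))`.  With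
the certified floor `ÊSS ≥ exp(−2τ̄σ̄²/n)` of the general-layer files this is `N ≥ e^{t + 2τ̄σ̄²/n}`. -/
theorem jarzynski_sampleSize_sufficient_of_ess (S : Fin (n + 1) → X → ℝ) (P : Fin n → X → X → ℝ)
    (hProw : ∀ k x, ∑ y, P k x y = 1) (hPpos : ∀ k x y, 0 < P k x y)
    (hst : ∀ k : Fin n, IsStationary (fun x => Real.exp (-(S k.succ x))) (P k))
    (f : (Fin (n + 1) → X) → ℝ) {t : ℝ} (ht : 0 ≤ t) {N : ℕ}
    (hN : Real.exp t / essFrac (revPathLaw S P) (pathLaw (gibbsLaw (S 0)) P) ≤ N) :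
    ∫ x, |(1 / (N : ℝ)) * ∑ i, f (x i)
          * Real.exp (-(work S (x i) - (freeEnergy (S (Fin.last n)) - freeEnergy (S 0))))
        - ∑ ω, revPathLaw S P ω * f ω| ∂(Measure.pi fun _ : Fin N => pathMeasure S P hProw hPpos)
      ≤ Real.sqrt (∑ ω, revPathLaw S P ω * f ω ^ 2) *
          (Real.exp (-t / 4) + 2 * Real.sqrt
            (∑ ω, if work S ω < (∑ ω', revPathLaw S P ω' * work S ω') - t / 2
              then revPathLaw S P ω else 0)) := by
  refine jarzynski_sampleSize_sufficient S P hProw hPpos hst f ht (le_trans ?_ hN)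
  have hE := essFrac_path_pos S hPpos hst
  have hL := reverseDissipation_le_neg_log_ess S P hPpos hst
  calc _ ≤ Real.exp (-Real.log (essFrac (revPathLaw S P) (pathLaw (gibbsLaw (S 0)) P)) + t) :=
        Real.exp_le_exp.mpr (by linarith)
    _ = Real.exp t / essFrac (revPathLaw S P) (pathLaw (gibbsLaw (S 0)) P) := by
        rw [Real.exp_add, Real.exp_neg, Real.exp_log hE, inv_mul_eq_div]

end Measures

end Summit.Ventures.LatticeQCDFlow.Theory2
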